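import Literature.AlgebraicGeometry.Resolution.BlowupChartRsop
import Literature.AlgebraicGeometry.Resolution.QuadraticTransformAlongPrime
import Literature.AlgebraicGeometry.Resolution.NormalCrossingsBlowupStepReduction
import HarnessLib

/-!
# Crux `Steer`, line `switching-dichotomy`: one quadratic transform monomializes parameters (stub `stub_rsopMonomialStep`)

For a regular local ring `R ⊆ K` dominated by a valuation ring `O` of the field `K` and its
quadratic transform `R₁` ALONG `O` (`IsQuadraticTransformAlong`, i.e.
`R₁ = (R[𝔪_R/x_i])_{𝔪_O ∩ R[𝔪_R/x_i]}` for a member `x_i` of minimal value of a regular system of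
parameters `x` of `R`), this file PROVES `stub_rsopMonomialStep`: every member of a given part `z`
of a regular system of parameters of `R` is, inside `K`, a monomial in a part `z₁` of a regular
system of parameters of `R₁` times a unit of `R₁` (HLOST, arXiv:1505.06445, Lemma 2.7; de Jong
1996, 2.4; Stacks 0BIQ).

Proof. Complete `z` to a regular system of parameters `x` of `R` (`IsRsopPart.exists_rsop`) and
pick `x_i` of minimal value; by uniqueness of the transform along `O`
(`IsQuadraticTransformAlong.unique`) `R₁ = (R[𝔪/x_i])_{𝔪_O ∩ R[𝔪/x_i]}`. The tree's chart theorem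
`isRsopPart_chartFamily_reesChart` (`BlowupChartRsop.lean`) says that in the localisation `L` of
the Rees chart `B = (R[𝔪t])_{(x_i t)}` at the centre `N` of `O` (`chartCentre`,
`QuadraticTransformAlongPrime.lean`) the family `(x_i, (e_j)_{j ∈ J})`, `e_j = (x_j t)/(x_i t)`,
`J = {j ≠ i : e_j ∈ N}`, is part of a regular system of parameters. The map `θ_L : L → K`
(`locToField`) is injective (because `B → K` is: `x_i` is a non-zero-divisor on the chart) with
image `(R[𝔪/x_i])_{𝔪_O ∩ R[𝔪/x_i]} = R₁` (`range_locToField`, `range_chartToField_eq_blowupRing`),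
so `L ≅ R₁` and the family `(x_i, (x_j/x_i)_{j ∈ J})` is part of a regular system of parameters of
`R₁` (`IsRsopPart.map_ringEquiv`); the quotients `x_j/x_i`, `j ∉ J`, have value `0` and are units
of `R₁`. Finally `x_j = x_i · (x_j/x_i)`.

Sources: HLOST = W. Heinzer, K. A. Loper, B. Olberding, H. Schoutens, M. Toeniskoetter, *Ideal
theory of infinite directed unions of local quadratic transforms*, arXiv:1505.06445, Lemma 2.7;
A. J. de Jong, *Smoothness, semi-stability and alterations*, Publ. Math. IHÉS 83 (1996), 2.4;
The Stacks Project, Tags 0804, 0BIQ.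
-/

set_option linter.dupNamespace false

open IsLocalRing
open Literature.AlgebraicGeometry.Resolution

namespace Summit.ResolutionOfSingularities.ResolutionOfSingularities.Theorems.SwitchingDichotomy

/-! ## Injectivity of the chart maps into `K` -/

/-- An injective ring map `f : A → K` with image the subring `T` gives `A ≅ T` over `K`.
[folklore] -/
theorem exists_ringEquiv_of_range_eq_rsopStep {A K : Type*} [Ring A] [Ring K] (f : A →+* K)
    (hf : Function.Injective f) (T : Subring K) (hT : f.range = T) :
    ∃ e : A ≃+* T, ∀ a, (e a : K) = f a := by
  subst hT
  exact ⟨RingEquiv.ofBijective f.rangeRestrict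
    ⟨fun a b h => hf (congrArg Subtype.val h :), f.rangeRestrict_surjective⟩, fun a => rfl⟩

/-- **The chart ring embeds into `K`.** For an injective ring map `θ : A → K` into a field and a
family `c` with `θ(c_i) ≠ 0`, the map `θ₁ : (A[It])_{(c_i t)} → K` (`chartToField`,
`F(e) ↦ F(θ(c)/θ(c_i))`) is injective: write two elements as `F₁(e)`, `F₂(e)` with forms of one
degree `d`; then `φ(F_k(c)) = φ(c_i)^d F_k(e)`, `F₁(c) = F₂(c)` in `A` (compare in `K`), and
`φ(c_i)` is a non-zero-divisor on the chart (Stacks 0804). [cite: StacksProject, Tag 0804] -/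
theorem chartToField_injective_rsopStep {A : Type*} [CommRing A] {K : Type*} [Field K] {n : ℕ}
    (c : Fin n → A) (i : Fin n) (θ : A →+* K) (hθ : θ (c i) ≠ 0) (hinj : Function.Injective θ) :
    Function.Injective (chartToField c i θ hθ) := by
  classical
  -- every element is `F(e)` for a form `F` of any large degree
  have hform : ∀ (z : chartRing c i) (m : ℕ), ∃ (d : ℕ) (F : MvPolynomial (Fin n) A), m ≤ d ∧
      F.IsHomogeneous d ∧ MvPolynomial.eval₂Hom (chartBase c i) (fun j => chartGen c i j) F = z := by
    intro z m
    obtain ⟨d, F, hF, hFz⟩ := exists_isHomogeneous_eval₂_eq c i z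
    refine ⟨m + d, MvPolynomial.X i ^ m * F, Nat.le_add_right m d,
      (MvPolynomial.isHomogeneous_X_pow i m).mul hF, ?_⟩
    rw [map_mul, map_pow, MvPolynomial.eval₂Hom_X', hFz]
    exact chartGen_self_pow_mul c i m z
  intro z₁ z₂ hz
  obtain ⟨d₁, F₁, -, hF₁, rfl⟩ := hform z₁ 0
  obtain ⟨d, F₂, hle, hF₂, rfl⟩ := hform z₂ d₁
  obtain ⟨k, rfl⟩ := Nat.exists_eq_add_of_le hle
  have hG₁hom : (MvPolynomial.X i ^ k * F₁).IsHomogeneous (d₁ + k) := by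
    rw [add_comm]
    exact (MvPolynomial.isHomogeneous_X_pow i k).mul hF₁
  have hG₁e : MvPolynomial.eval₂Hom (chartBase c i) (fun j => chartGen c i j)
      (MvPolynomial.X i ^ k * F₁) =
      MvPolynomial.eval₂Hom (chartBase c i) (fun j => chartGen c i j) F₁ := by
    rw [map_mul, map_pow, MvPolynomial.eval₂Hom_X']
    exact chartGen_self_pow_mul c i k _
  have h1 := reesChartBase_eval_eq_pow_mul_eval₂ c i hG₁hom
  have h2 := reesChartBase_eval_eq_pow_mul_eval₂ c i hF₂
  rw [hG₁e] at h1
  -- compare in `K`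
  have hK : θ (MvPolynomial.eval c (MvPolynomial.X i ^ k * F₁)) = θ (MvPolynomial.eval c F₂) := by
    rw [← chartToField_reesChartBase c i θ hθ, ← chartToField_reesChartBase c i θ hθ, h1, h2,
      map_mul, map_mul, hz]
  have hA : MvPolynomial.eval c (MvPolynomial.X i ^ k * F₁) = MvPolynomial.eval c F₂ := hinj hK
  have h3 : chartBase c i (c i) ^ (d₁ + k) *
      MvPolynomial.eval₂Hom (chartBase c i) (fun j => chartGen c i j) F₁ =
      chartBase c i (c i) ^ (d₁ + k) *
      MvPolynomial.eval₂Hom (chartBase c i) (fun j => chartGen c i j) F₂ := by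
    rw [← h1, ← h2, hA]
  have hnzd : chartBase c i (c i) ^ (d₁ + k) ∈ nonZeroDivisors (chartRing c i) :=
    pow_mem (reesChartBase_mem_nonZeroDivisors (c i) (Ideal.mem_span_range_self (f := c) (x := i))) _
  exact (mul_cancel_left_mem_nonZeroDivisors hnzd).mp h3

/-- Hence **`θ_L : L = B_N → K` (`locToField`) is injective** for `θ` injective: `θ_L(b/s) =
θ₁(b)/θ₁(s)` with `θ₁(s) ≠ 0`. [folklore] -/
theorem locToField_injective_rsopStep {A : Type*} [CommRing A] {K : Type*} [Field K] {n : ℕ}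
    (c : Fin n → A) (i : Fin n) (θ : A →+* K) (hθ : θ (c i) ≠ 0) (hinj : Function.Injective θ)
    (O : ValuationSubring K) (hRO : ∀ r, θ r ∈ O)
    (hmin : ∀ j, O.valuation (θ (c j)) ≤ O.valuation (θ (c i)))
    (L : Type*) [CommRing L] [Algebra (chartRing c i) L]
    [IsLocalization.AtPrime L (chartCentre c i θ hθ O hRO hmin)] :
    Function.Injective (locToField c i θ hθ O hRO hmin L) := by
  rw [injective_iff_map_eq_zero]
  intro l hl
  obtain ⟨⟨b, s⟩, rfl⟩ :=
    IsLocalization.mk'_surjective (chartCentre c i θ hθ O hRO hmin).primeCompl l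
  rw [locToField_mk', div_eq_zero_iff] at hl
  rcases hl with hb | hs
  · have hb0 : b = 0 := chartToField_injective_rsopStep c i θ hθ hinj (by rw [hb, map_zero])
    subst hb0
    exact IsLocalization.mk'_zero s
  · exact absurd hs (ne_zero_of_valuation_eq_one
      ((not_mem_chartCentre_iff c i θ hθ O hRO hmin s.1).mp s.2))

/-! ## The exceptional parameter and the strict transforms in `R₁` -/

/-- **HLOST Lemma 2.7 / de Jong 2.4 inside `K`.** Let `R ⊆ K` be a regular local ring dominated by
the valuation ring `O`, `x` a regular system of parameters of `R`, `x_i ≠ 0` of minimal value, and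
`R₁ = (R[𝔪_R/x_i])_{𝔪_O ∩ R[𝔪_R/x_i]}`. For any injective enumeration `jJ` of indices `j ≠ i`
with `x_j/x_i` of positive value, the family `(x_i, (x_{jJ k}/x_i)_k)` of elements of `R₁` is part
of a regular system of parameters of `R₁`: the Rees-chart theorem
`isRsopPart_chartFamily_reesChart` in the localisation of the chart at the centre of `O`,
transported along the isomorphism `θ_L` onto `R₁` (`range_locToField`,
`range_chartToField_eq_blowupRing`). [cite: DeJong1996, 2.4] [cite: StacksProject, Tag 0BIQ] -/
theorem exists_isRsopPart_quadraticTransform_rsopStep {K : Type} [Field K] (R : Subring K)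
    [IsRegularLocalRing R] (O : ValuationSubring K) (hdom : SubringDominates R O.toSubring)
    {n : ℕ} (hd : (maximalIdeal R).spanFinrank = n) (x : Fin n → R)
    (hx : Ideal.span (Set.range x) = maximalIdeal R) (i : Fin n) (hxi : ((x i : R) : K) ≠ 0)
    (hmin : ∀ j, O.valuation ((x j : R) : K) ≤ O.valuation ((x i : R) : K))
    {a : ℕ} (jJ : Fin a → {j : Fin n // j ≠ i}) (hjJ : Function.Injective jJ)
    (hJ : ∀ k, O.valuation (((x (jJ k).1 : R) : K) / ((x i : R) : K)) < 1)
    (R₁ : Subring K) [IsLocalRing R₁] (hR₁ : R₁ = locAtCentre (blowupRing R ((x i : R) : K)) O) :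
    ∃ z₁ : Fin (a + 1) → R₁, IsRsopPart z₁ ∧ ((z₁ 0 : R₁) : K) = ((x i : R) : K) ∧
      ∀ k, ((z₁ (Fin.succ k) : R₁) : K) = ((x (jJ k).1 : R) : K) / ((x i : R) : K) := by
  classical
  have hθ : R.subtype (x i) ≠ 0 := hxi
  have hRO : ∀ r : R, R.subtype r ∈ O := fun r => hdom.1 r.2
  have hmin' : ∀ j, O.valuation (R.subtype (x j)) ≤ O.valuation (R.subtype (x i)) := hmin
  have hdom' : ∀ r ∈ maximalIdeal R, O.valuation (R.subtype r) < 1 := fun r hr =>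
    ((subringDominates_valuationSubring_iff hdom.1).mp hdom r).mp hr
  -- the centre of `O` on the chart and the local ring of the chart at it
  set N := chartCentre x i R.subtype hθ O hRO hmin' with hN
  have hNm : N.comap (chartBase x i) = maximalIdeal R :=
    comap_reesChartBase_chartCentre x i R.subtype hθ O hRO hmin' hdom'
  have hz' : Ideal.span (Set.range (Fin.append x Fin.elim0)) = maximalIdeal R := by
    rw [← hx]
    congr 1
    ext r
    constructor
    · rintro ⟨j, rfl⟩
      induction j using Fin.addCases with
      | left j => exact ⟨j, by simp⟩
      | right k => exact k.elim0
    · rintro ⟨j, rfl⟩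
      exact ⟨Fin.castAdd 0 j, by simp⟩
  have hJ' : ∀ k, chartGen x i (jJ k).1 ∈ N := fun k => by
    rw [hN, mem_chartCentre_iff, chartToField_chartGen]
    exact hJ k
  have hpart := isRsopPart_chartFamily_reesChart x i Fin.elim0 hz' hd N hNm
    (Localization.AtPrime N) jJ hjJ hJ'
  -- `θ_L : L ≅ R₁`
  set f := locToField x i R.subtype hθ O hRO hmin' (Localization.AtPrime N) with hf
  have hfinj : Function.Injective f :=
    locToField_injective_rsopStep x i R.subtype hθ Subtype.val_injective O hRO hmin' _
  have hrange : f.range = R₁ := by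
    rw [hR₁, hf, range_locToField,
      range_chartToField_eq_blowupRing x i R.subtype hθ hx R (Subring.range_subtype R)]
    rfl
  obtain ⟨e, he⟩ := exists_ringEquiv_of_range_eq_rsopStep f hfinj R₁ hrange
  -- the chart family, re-indexed by `Fin (a + 1)` (definitionally `Fin (a + 0 + 1)`)
  refine ⟨fun k => e (chartFamily x i Fin.elim0 (Localization.AtPrime N) (chartBase x i)
    (chartGen x i) jJ k), ?_, ?_, fun k => ?_⟩
  · exact hpart.map_ringEquiv e
  · show ((e (chartFamily x i Fin.elim0 (Localization.AtPrime N) (chartBase x i) (chartGen x i) jJ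
      (0 : Fin (a + 0 + 1))) : R₁) : K) = _
    rw [he, chartFamily, Fin.cons_zero, hf, locToField_algebraMap, chartToField_reesChartBase]
    rfl
  · show ((e (chartFamily x i Fin.elim0 (Localization.AtPrime N) (chartBase x i) (chartGen x i) jJ
      (Fin.succ (Fin.castAdd 0 k))) : R₁) : K) = _
    rw [he, chartFamily, Fin.cons_succ, Fin.append_left, hf, locToField_algebraMap,
      chartToField_chartGen]
    rfl

/-! ## The stub -/

/-- **`stub_rsopMonomialStep` (HLOST Lemma 2.7 = de Jong 1996, 2.4 / Stacks 0BIQ, inside `K`).**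
Let `R ⊆ K` be a local ring dominated by the valuation ring `O`, `R₁` its quadratic transform
along `O`, and `z` part of a regular system of parameters of `R` (so `R` is regular). Then there is
a part `z₁` of a regular system of parameters of `R₁` such that every `z_j` is a monomial in `z₁`
times a unit of `R₁`: complete `z` to a regular system of parameters `x`, let `x_i` have minimal
value, so that `R₁ = (R[𝔪/x_i])_{𝔪_O ∩ R[𝔪/x_i]}` (uniqueness of the transform along `O`); take
`z₁ = (x_i, (x_j/x_i)_{j ∈ J})` with `J` the indices `j ≠ i` for which `x_j/x_i` has positive
value (`exists_isRsopPart_quadraticTransform_rsopStep`); the other `x_j/x_i` are units of `R₁`,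
and `x_j = x_i · (x_j/x_i)`. [cite: HeinzerEtAl2015, Lemma 2.7] [cite: DeJong1996, 2.4] -/
theorem stub_rsopMonomialStep (K : Type) [Field K] (O : ValuationSubring K) (R R₁ : Subring K)
    [IsLocalRing R] [IsLocalRing R₁] (hdom : SubringDominates R O.toSubring)
    (h : IsQuadraticTransformAlong O R R₁) (s : ℕ) (z : Fin s → R) (hz : IsRsopPart z) :
    ∃ (s₁ : ℕ) (z₁ : Fin s₁ → R₁), IsRsopPart z₁ ∧
      ∀ j : Fin s, ∃ (e : Fin s₁ → ℕ) (u : R₁), IsUnit u ∧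
        ((z j : R) : K) = (∏ l, ((z₁ l : R₁) : K) ^ e l) * (u : K) := by
  classical
  haveI := hz.isRegularLocalRing
  have hRO := h.source_le
  have hR₁O := h.target_le
  obtain ⟨e, x, hd, hx, hxz⟩ := hz.exists_rsop
  obtain ⟨_, x₀, hx₀m, hx₀0, -, -⟩ := h.exists_eq_locAtCentre
  -- some parameter is nonzero (as `𝔪_R ≠ 0`)
  have hne : ∃ j ∈ (Finset.univ : Finset (Fin (s + e))), ((x j : R) : K) ≠ 0 := by
    by_contra hcon
    have hall : ∀ j, x j = 0 := fun j => by
      by_contra hj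
      exact hcon ⟨j, Finset.mem_univ j, fun h0 => hj (Subtype.ext h0)⟩
    have hbot : Ideal.span (Set.range x) = ⊥ := by
      rw [Ideal.span_eq_bot]
      rintro _ ⟨j, rfl⟩
      exact hall j
    rw [hx] at hbot
    rw [hbot] at hx₀m
    exact hx₀0 ((Submodule.mem_bot _).mp hx₀m)
  obtain ⟨i, -, hi0, hmax⟩ := exists_max_valuation O Finset.univ (fun j => ((x j : R) : K)) hne
  have hxi : x i ≠ 0 := fun h0 => hi0 (by rw [h0]; rfl)
  -- `R₁` is the transform in the `x_i`-chart
  have hspan : Ideal.span (↑(Finset.univ.image x) : Set R) = maximalIdeal R := by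
    rw [Finset.coe_image, Finset.coe_univ, Set.image_univ, hx]
  have h' : IsQuadraticTransformAlong O R (locAtCentre (blowupRing R (x i : K)) O) := by
    refine ⟨‹_›, hRO, Finset.univ.image x, x i, hspan, Finset.mem_image_of_mem x (Finset.mem_univ i),
      hxi, ?_, ?_⟩
    · intro y hy
      obtain ⟨j, -, rfl⟩ := Finset.mem_image.mp hy
      exact hmax j (Finset.mem_univ j)
    · rw [blowupRing_eq_closure_of_span_eq (x i : K) _ hspan]
  have hR₁ : R₁ = locAtCentre (blowupRing R (x i : K)) O := h.unique h'
  -- the quotients `x_j / x_i` of positive value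
  set J : Finset {j : Fin (s + e) // j ≠ i} :=
    Finset.univ.filter fun j => O.valuation (((x j.1 : R) : K) / ((x i : R) : K)) < 1 with hJdef
  set jJ : Fin J.card → {j : Fin (s + e) // j ≠ i} := fun k => (J.equivFin.symm k).1 with hjJdef
  have hjJ : Function.Injective jJ := fun a b hab =>
    J.equivFin.symm.injective (Subtype.ext hab)
  have hJ : ∀ k, O.valuation (((x (jJ k).1 : R) : K) / ((x i : R) : K)) < 1 := fun k =>
    (Finset.mem_filter.mp (J.equivFin.symm k).2).2
  obtain ⟨z₁, hz₁, hz₁0, hz₁k⟩ := exists_isRsopPart_quadraticTransform_rsopStep R O hdom hd x hx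
    i hi0 (fun j => hmax j (Finset.mem_univ j)) jJ hjJ hJ R₁ hR₁
  refine ⟨J.card + 1, z₁, hz₁, fun j => ?_⟩
  rw [← hxz j]
  by_cases hki : Fin.castAdd e j = i
  · -- the exceptional parameter itself
    refine ⟨Pi.single 0 1, 1, isUnit_one, ?_⟩
    rw [hki, Finset.prod_eq_single (0 : Fin (J.card + 1)) (fun l _ hl => by
      rw [Pi.single_eq_of_ne hl, pow_zero]) (fun h0 => absurd (Finset.mem_univ _) h0),
      Pi.single_eq_same, pow_one, hz₁0, OneMemClass.coe_one, mul_one]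
  · have hfac : ((x (Fin.castAdd e j) : R) : K) =
        ((x i : R) : K) * (((x (Fin.castAdd e j) : R) : K) / ((x i : R) : K)) :=
      (mul_div_cancel₀ _ hi0).symm
    by_cases hv : O.valuation (((x (Fin.castAdd e j) : R) : K) / ((x i : R) : K)) < 1
    · -- a strict transform through the new centre: `x_j = x_i · (x_j / x_i)`, both in `z₁`
      have hmem : (⟨Fin.castAdd e j, hki⟩ : {j : Fin (s + e) // j ≠ i}) ∈ J :=
        Finset.mem_filter.mpr ⟨Finset.mem_univ _, hv⟩
      set m : Fin J.card := J.equivFin ⟨_, hmem⟩ with hm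
      have hjm : jJ m = ⟨Fin.castAdd e j, hki⟩ := by
        rw [hjJdef, hm]
        dsimp only
        rw [Equiv.symm_apply_apply]
      have hl₁ : (0 : Fin (J.card + 1)) ≠ Fin.succ m :=
        (Fin.succ_ne_zero _).symm
      refine ⟨Pi.single 0 1 + Pi.single (Fin.succ m) 1, 1, isUnit_one, ?_⟩
      rw [Finset.prod_eq_mul (0 : Fin (J.card + 1)) (Fin.succ m) hl₁
        (fun c _ hc => by
          rw [Pi.add_apply, Pi.single_eq_of_ne hc.1, Pi.single_eq_of_ne hc.2, add_zero, pow_zero])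
        (fun h0 => absurd (Finset.mem_univ _) h0) (fun h0 => absurd (Finset.mem_univ _) h0),
        Pi.add_apply, Pi.add_apply, Pi.single_eq_same, Pi.single_eq_same, Pi.single_eq_of_ne hl₁,
        Pi.single_eq_of_ne hl₁.symm, add_zero, zero_add, pow_one, pow_one, hz₁0, hz₁k m, hjm,
        OneMemClass.coe_one, mul_one]
      exact hfac
    · -- a strict transform off the new centre: `x_j / x_i` is a unit of `R₁`
      have hwR₁ : ((x (Fin.castAdd e j) : R) : K) / ((x i : R) : K) ∈ R₁ := by
        rw [hR₁]
        exact le_locAtCentre _ O (div_mem_blowupRing _ (hx ▸ Ideal.subset_span ⟨_, rfl⟩))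
      have hv1 : O.valuation (((x (Fin.castAdd e j) : R) : K) / ((x i : R) : K)) = 1 :=
        le_antisymm ((O.valuation_le_one_iff _).mpr (hR₁O hwR₁)) (not_lt.mp hv)
      refine ⟨Pi.single 0 1, ⟨_, hwR₁⟩, ?_, ?_⟩
      · rw [isUnit_subring_iff_inv_mem]
        refine ⟨ne_zero_of_valuation_eq_one hv1, ?_⟩
        have hwL : ((x (Fin.castAdd e j) : R) : K) / ((x i : R) : K) ∈
            locAtCentre (blowupRing R (x i : K)) O := by
          rw [← hR₁]
          exact hwR₁
        show (((x (Fin.castAdd e j) : R) : K) / ((x i : R) : K))⁻¹ ∈ R₁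
        rw [hR₁]
        exact inv_mem_locAtCentre hwL hv1
      · rw [Finset.prod_eq_single (0 : Fin (J.card + 1)) (fun l _ hl => by
          rw [Pi.single_eq_of_ne hl, pow_zero]) (fun h0 => absurd (Finset.mem_univ _) h0),
          Pi.single_eq_same, pow_one, hz₁0]
        exact hfac

end Summit.ResolutionOfSingularities.ResolutionOfSingularities.Theorems.SwitchingDichotomy
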